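import Summits.NavierStokesRegularity.NavierStokesRegularity.Theorems.TypeIIInviscidRelaxationAxisymSwirlRegularZhangBarrierProfileW
import Summits.NavierStokesRegularity.NavierStokesRegularity.Theorems.TypeIIInviscidRelaxationAxisymSwirlRegularZhangBarrierProfileBounds
import HarnessLib

/-!
# The κ-inflow barriers, `κ ∈ (0,1]`: power bounds for the profile `F_W`

Helper toward the crux `AxisymSwirlRegular` (stmt-NavierStokesRegularity-1964, route TypeIIInviscidRelaxation),
registered line `radial_inflow_split`, criterion side (⟨19059⟩); continuation of `…ZhangBarrierProfileW`
(the κ-analogue of `…ZhangBarrierProfileBounds`).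

THIS FILE: for `0 < κ ≤ 1`, `M > 0`, with `X = ξ^{2−κ}`, `W = X − 2M`, `e = 2m_W/(2−κ)` (so `X^e = ξ^{2m_W}`):
* `profW_le` — `F_W(ξ) ≤ C₀ ξ^{2m}` on `[0,∞)`, `C₀ = (4M+3)(M/κ+1)` (uses `2m_W ≤ κ` near `0`: `u ≤ h = (M/κ)ξ^κ`);
* `profW_ge_rpow` — `F_W(ξ) ≥ κ₁(ξ₁) ξ^{2m}` for `ξ ≥ ξ₁ > 0`;
* `profW_ge_sq` — `F_W(ξ) ≥ κ₂(ξ₂) ξ²` for `0 ≤ ξ ≤ ξ₂` (`u ≥ h e^{−h}`).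
The `arsinh` comparisons are the κ = 1 lemmas `exp_arsinh_le` / `le_exp_arsinh` at `ξ ↦ X`, `c ↦ M`.

Pure Mathlib real analysis; no NS statement here. [new]
-/

noncomputable section

set_option linter.dupNamespace false

open Set Real

namespace Summit.NavierStokesRegularity.NavierStokesRegularity.Theorems.ZhangBarrier

/-- The growth constant `C₀ = (4M+3)(M/κ + 1)`. [new] -/
def C0W (κ M : ℝ) : ℝ := (4 * M + 3) * (M / κ + 1)

/-- `C₀ > 0`. -/
theorem C0W_pos {κ M : ℝ} (hκ : 0 < κ) (hM : 0 < M) : 0 < C0W κ M := by unfold C0W; positivity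

/-- The exponent identity `(ξ^{2−κ})^{2m/(2−κ)} = ξ^{2m}` (`ξ ≥ 0`). -/
theorem rpow_X_e {κ ξ m : ℝ} (hκ1 : κ ≤ 1) (hξ : 0 ≤ ξ) :
    (ξ ^ (2 - κ)) ^ (2 * m / (2 - κ)) = ξ ^ (2 * m) := by
  rw [← rpow_mul hξ]
  congr 1
  have : (2 - κ) ≠ 0 := by linarith
  field_simp

/-- `v ≤ (4M+3) ξ^{2m}` for `ξ ≥ 1`. -/
theorem vW_le_of_one_le {κ M ξ : ℝ} (hκ0 : 0 < κ) (hκ1 : κ ≤ 1) (hM : 0 < M) (hξ : 1 ≤ ξ) :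
    vW κ M ξ ≤ (4 * M + 3) * ξ ^ (2 * expoW κ M) := by
  have hm := expoW_pos hκ0 hM
  have hA := bigAW_pos hκ0 M
  have h2κ : 0 < 2 - κ := by linarith
  have he0 : 0 ≤ 2 * expoW κ M / (2 - κ) := by positivity
  have he1 : 2 * expoW κ M / (2 - κ) ≤ 1 := by
    rw [div_le_one h2κ]; linarith [two_expoW_le hκ0 hM]
  set X := ξ ^ (2 - κ) with hX
  have hX1 : 1 ≤ X := one_le_rpow hξ h2κ.le
  have hX0 : 0 ≤ X := by linarith
  unfold vW psiW
  have h1 : expoW κ M * (-(bigAW κ M / M) * exp (-hK κ M ξ) + 2 / (2 - κ) * arsinh (WK κ M ξ))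
      ≤ arsinh (WK κ M ξ) * (2 * expoW κ M / (2 - κ)) := by
    have : 0 ≤ bigAW κ M / M * exp (-hK κ M ξ) := by positivity
    have e : expoW κ M * (-(bigAW κ M / M) * exp (-hK κ M ξ) + 2 / (2 - κ) * arsinh (WK κ M ξ))
        = -(expoW κ M * (bigAW κ M / M * exp (-hK κ M ξ))) + arsinh (WK κ M ξ) * (2 * expoW κ M / (2 - κ)) := by
      ring
    rw [e]
    have := mul_nonneg hm.le this
    linarith
  have hW : WK κ M ξ = X - 2 * M := rfl
  calc exp (expoW κ M * (-(bigAW κ M / M) * exp (-hK κ M ξ) + 2 / (2 - κ) * arsinh (WK κ M ξ)))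
      ≤ exp (arsinh (WK κ M ξ) * (2 * expoW κ M / (2 - κ))) := exp_le_exp.2 h1
    _ = (exp (arsinh (X - 2 * M))) ^ (2 * expoW κ M / (2 - κ)) := by rw [hW]; exact exp_mul _ _
    _ ≤ (2 * X + 4 * M + 1) ^ (2 * expoW κ M / (2 - κ)) :=
        rpow_le_rpow (exp_pos _).le (exp_arsinh_le hM hX0) he0
    _ ≤ ((4 * M + 3) * X) ^ (2 * expoW κ M / (2 - κ)) := rpow_le_rpow (by positivity) (by nlinarith) he0
    _ = (4 * M + 3) ^ (2 * expoW κ M / (2 - κ)) * X ^ (2 * expoW κ M / (2 - κ)) :=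
        mul_rpow (by positivity) hX0
    _ ≤ (4 * M + 3) * ξ ^ (2 * expoW κ M) := by
        rw [hX, rpow_X_e hκ1 (by linarith)]
        apply mul_le_mul_of_nonneg_right _ (by positivity)
        calc (4 * M + 3) ^ (2 * expoW κ M / (2 - κ)) ≤ (4 * M + 3) ^ (1 : ℝ) :=
              rpow_le_rpow_of_exponent_le (by linarith) he1
          _ = 4 * M + 3 := rpow_one _

/-- `v ≤ 4M+3` for `0 ≤ ξ ≤ 1`. -/
theorem vW_le_of_le_one {κ M ξ : ℝ} (hκ0 : 0 < κ) (hκ1 : κ ≤ 1) (hM : 0 < M) (h0 : 0 ≤ ξ) (h1 : ξ ≤ 1) :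
    vW κ M ξ ≤ 4 * M + 3 := by
  have hm := expoW_pos hκ0 hM
  have hA := bigAW_pos hκ0 M
  have h2κ : 0 < 2 - κ := by linarith
  have he0 : 0 ≤ 2 * expoW κ M / (2 - κ) := by positivity
  have he1 : 2 * expoW κ M / (2 - κ) ≤ 1 := by
    rw [div_le_one h2κ]; linarith [two_expoW_le hκ0 hM]
  set X := ξ ^ (2 - κ) with hX
  have hX1 : X ≤ 1 := rpow_le_one h0 h1 h2κ.le
  have hX0 : 0 ≤ X := rpow_nonneg h0 _
  unfold vW psiW
  have hh1 : expoW κ M * (-(bigAW κ M / M) * exp (-hK κ M ξ) + 2 / (2 - κ) * arsinh (WK κ M ξ))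
      ≤ arsinh (WK κ M ξ) * (2 * expoW κ M / (2 - κ)) := by
    have : 0 ≤ bigAW κ M / M * exp (-hK κ M ξ) := by positivity
    have e : expoW κ M * (-(bigAW κ M / M) * exp (-hK κ M ξ) + 2 / (2 - κ) * arsinh (WK κ M ξ))
        = -(expoW κ M * (bigAW κ M / M * exp (-hK κ M ξ))) + arsinh (WK κ M ξ) * (2 * expoW κ M / (2 - κ)) := by
      ring
    rw [e]
    have := mul_nonneg hm.le this
    linarith
  have hW : WK κ M ξ = X - 2 * M := rfl
  calc exp (expoW κ M * (-(bigAW κ M / M) * exp (-hK κ M ξ) + 2 / (2 - κ) * arsinh (WK κ M ξ)))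
      ≤ exp (arsinh (WK κ M ξ) * (2 * expoW κ M / (2 - κ))) := exp_le_exp.2 hh1
    _ = (exp (arsinh (X - 2 * M))) ^ (2 * expoW κ M / (2 - κ)) := by rw [hW]; exact exp_mul _ _
    _ ≤ (2 * X + 4 * M + 1) ^ (2 * expoW κ M / (2 - κ)) :=
        rpow_le_rpow (exp_pos _).le (exp_arsinh_le hM hX0) he0
    _ ≤ (4 * M + 3) ^ (2 * expoW κ M / (2 - κ)) := rpow_le_rpow (by positivity) (by linarith) he0
    _ ≤ (4 * M + 3) ^ (1 : ℝ) := rpow_le_rpow_of_exponent_le (by linarith) he1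
    _ = 4 * M + 3 := rpow_one _

/-- `u ≤ h = (M/κ) ξ^κ` (from `1 − e^{−h} ≤ h`). -/
theorem uK_le_hK (κ M ξ : ℝ) : uK κ M ξ ≤ hK κ M ξ := by
  unfold uK
  have := add_one_le_exp (-hK κ M ξ)
  linarith

/-- **Growth bound** `F_W(ξ) ≤ C₀ ξ^{2m}` on `[0,∞)`. [new] -/
theorem profW_le {κ M ξ : ℝ} (hκ0 : 0 < κ) (hκ1 : κ ≤ 1) (hM : 0 < M) (hξ : 0 ≤ ξ) :
    profW κ M ξ ≤ C0W κ M * ξ ^ (2 * expoW κ M) := by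
  have hm := expoW_pos hκ0 hM
  rcases hξ.eq_or_lt with h0 | hpos
  · rw [← h0, profW_zero hκ0, zero_rpow (by positivity)]; simp
  unfold profW C0W
  have hv := vW_pos κ M ξ
  have hu0 := uK_nonneg hκ0 hM hξ
  rcases le_or_gt 1 ξ with h1 | h1
  · have hu1 := uK_le_one κ M ξ
    have hvb := vW_le_of_one_le hκ0 hκ1 hM h1
    have hr : 0 ≤ ξ ^ (2 * expoW κ M) := by positivity
    have hMk : 0 ≤ M / κ := by positivity
    calc uK κ M ξ * vW κ M ξ ≤ 1 * ((4 * M + 3) * ξ ^ (2 * expoW κ M)) := by gcongr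
      _ ≤ (4 * M + 3) * (M / κ + 1) * ξ ^ (2 * expoW κ M) := by nlinarith
  · have hu1 := uK_le_hK κ M ξ
    have hvb := vW_le_of_le_one hκ0 hκ1 hM hξ h1.le
    have hr : ξ ^ κ ≤ ξ ^ (2 * expoW κ M) :=
      rpow_le_rpow_of_exponent_ge hpos h1.le (two_expoW_le hκ0 hM)
    have hh : hK κ M ξ ≤ M / κ * ξ ^ (2 * expoW κ M) := by
      unfold hK; exact mul_le_mul_of_nonneg_left hr (by positivity)
    calc uK κ M ξ * vW κ M ξ ≤ (M / κ * ξ ^ (2 * expoW κ M)) * (4 * M + 3) := by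
          apply mul_le_mul (hu1.trans hh) hvb hv.le (by positivity)
      _ = (4 * M + 3) * (M / κ) * ξ ^ (2 * expoW κ M) := by ring
      _ ≤ (4 * M + 3) * (M / κ + 1) * ξ ^ (2 * expoW κ M) := by
          have : 0 ≤ ξ ^ (2 * expoW κ M) := by positivity
          nlinarith

/-- Lower bound `v ≥ e^{−mA/M} (X/(4M+1)²)^{2m/(2−κ)}`, `X = ξ^{2−κ}`, on `[0,∞)`. -/
theorem vW_ge {κ M ξ : ℝ} (hκ0 : 0 < κ) (hκ1 : κ ≤ 1) (hM : 0 < M) (hξ : 0 ≤ ξ) :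
    exp (-(expoW κ M * bigAW κ M / M)) * (ξ ^ (2 - κ) / (4 * M + 1) ^ 2) ^ (2 * expoW κ M / (2 - κ))
      ≤ vW κ M ξ := by
  have hm := expoW_pos hκ0 hM
  have hA := bigAW_pos hκ0 M
  have h2κ : 0 < 2 - κ := by linarith
  have he0 : 0 ≤ 2 * expoW κ M / (2 - κ) := by positivity
  set X := ξ ^ (2 - κ) with hX
  have hX0 : 0 ≤ X := rpow_nonneg hξ _
  unfold vW psiW
  have hE : exp (-hK κ M ξ) ≤ 1 := by rw [exp_le_one_iff]; linarith [hK_nonneg hκ0 hM hξ]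
  have h1 : -(expoW κ M * bigAW κ M / M) + arsinh (WK κ M ξ) * (2 * expoW κ M / (2 - κ))
      ≤ expoW κ M * (-(bigAW κ M / M) * exp (-hK κ M ξ) + 2 / (2 - κ) * arsinh (WK κ M ξ)) := by
    have : bigAW κ M / M * exp (-hK κ M ξ) ≤ bigAW κ M / M := by
      have := mul_le_mul_of_nonneg_left hE (by positivity : 0 ≤ bigAW κ M / M); linarith
    have := mul_le_mul_of_nonneg_left this hm.le
    have e : expoW κ M * (-(bigAW κ M / M) * exp (-hK κ M ξ) + 2 / (2 - κ) * arsinh (WK κ M ξ))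
        = -(expoW κ M * (bigAW κ M / M * exp (-hK κ M ξ))) + arsinh (WK κ M ξ) * (2 * expoW κ M / (2 - κ)) := by
      ring
    rw [e]
    have e2 : expoW κ M * bigAW κ M / M = expoW κ M * (bigAW κ M / M) := by ring
    rw [e2]
    linarith
  have hW : WK κ M ξ = X - 2 * M := rfl
  calc exp (-(expoW κ M * bigAW κ M / M)) * (X / (4 * M + 1) ^ 2) ^ (2 * expoW κ M / (2 - κ))
      ≤ exp (-(expoW κ M * bigAW κ M / M)) * (exp (arsinh (X - 2 * M))) ^ (2 * expoW κ M / (2 - κ)) := by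
        apply mul_le_mul_of_nonneg_left _ (exp_pos _).le
        exact rpow_le_rpow (by positivity) (le_exp_arsinh hM hX0) he0
    _ = exp (-(expoW κ M * bigAW κ M / M) + arsinh (WK κ M ξ) * (2 * expoW κ M / (2 - κ))) := by
        rw [exp_add, exp_mul, hW]
    _ ≤ _ := exp_le_exp.2 h1

/-- Lower bound `v ≥ e^{−m(A/M + (2/(2−κ)) arsinh 2M)}` on `[0,∞)`. -/
theorem vW_ge_const {κ M ξ : ℝ} (hκ0 : 0 < κ) (hκ1 : κ ≤ 1) (hM : 0 < M) (hξ : 0 ≤ ξ) :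
    exp (-(expoW κ M * (bigAW κ M / M + 2 / (2 - κ) * arsinh (2 * M)))) ≤ vW κ M ξ := by
  have hm := expoW_pos hκ0 hM
  have hA := bigAW_pos hκ0 M
  have h2κ : 0 < 2 - κ := by linarith
  unfold vW psiW
  apply exp_le_exp.2
  have hE : exp (-hK κ M ξ) ≤ 1 := by rw [exp_le_one_iff]; linarith [hK_nonneg hκ0 hM hξ]
  have h1 : bigAW κ M / M * exp (-hK κ M ξ) ≤ bigAW κ M / M := by
    have := mul_le_mul_of_nonneg_left hE (by positivity : 0 ≤ bigAW κ M / M); linarith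
  have hX0 : 0 ≤ ξ ^ (2 - κ) := rpow_nonneg hξ _
  have h2 : arsinh (-(2 * M)) ≤ arsinh (WK κ M ξ) := arsinh_le_arsinh.2 (by unfold WK; linarith)
  rw [arsinh_neg] at h2
  have e : expoW κ M * (-(bigAW κ M / M) * exp (-hK κ M ξ) + 2 / (2 - κ) * arsinh (WK κ M ξ))
      = -(expoW κ M * (bigAW κ M / M * exp (-hK κ M ξ)))
        + (2 / (2 - κ)) * (expoW κ M * arsinh (WK κ M ξ)) := by ring
  have e2 : -(expoW κ M * (bigAW κ M / M + 2 / (2 - κ) * arsinh (2 * M)))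
      = -(expoW κ M * (bigAW κ M / M)) - (2 / (2 - κ)) * (expoW κ M * arsinh (2 * M)) := by ring
  rw [e, e2]
  have h3 := mul_le_mul_of_nonneg_left h1 hm.le
  have h4 := mul_le_mul_of_nonneg_left h2 hm.le
  have h5 : 0 ≤ 2 / (2 - κ) := by positivity
  have h6 := mul_le_mul_of_nonneg_left h4 h5
  linarith

/-- `u` is nondecreasing on `[0,∞)`: `u(ξ₁) ≤ u(ξ)` for `0 ≤ ξ₁ ≤ ξ`. -/
theorem uK_mono {κ M ξ₁ ξ : ℝ} (hκ0 : 0 < κ) (hM : 0 < M) (h1 : 0 ≤ ξ₁) (hξ : ξ₁ ≤ ξ) :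
    uK κ M ξ₁ ≤ uK κ M ξ := by
  unfold uK hK
  have : ξ₁ ^ κ ≤ ξ ^ κ := rpow_le_rpow h1 hξ hκ0.le
  have : M / κ * ξ₁ ^ κ ≤ M / κ * ξ ^ κ := mul_le_mul_of_nonneg_left this (by positivity)
  have := exp_le_exp.2 (neg_le_neg this)
  linarith

/-- `u(ξ₁) > 0` for `ξ₁ > 0`. -/
theorem uK_pos {κ M ξ₁ : ℝ} (hκ0 : 0 < κ) (hM : 0 < M) (h1 : 0 < ξ₁) : 0 < uK κ M ξ₁ := by
  unfold uK hK
  have : 0 < M / κ * ξ₁ ^ κ := by have := rpow_pos_of_pos h1 κ; positivity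
  have : exp (-(M / κ * ξ₁ ^ κ)) < 1 := exp_lt_one_iff.2 (by linarith)
  linarith

/-- The constant `κ₁(ξ₁) = u(ξ₁) e^{−mA/M} / ((4M+1)²)^{2m/(2−κ)}`. [new] -/
def kappa1W (κ M ξ₁ : ℝ) : ℝ :=
  uK κ M ξ₁ * exp (-(expoW κ M * bigAW κ M / M)) / ((4 * M + 1) ^ 2) ^ (2 * expoW κ M / (2 - κ))

/-- `κ₁ > 0`. -/
theorem kappa1W_pos {κ M ξ₁ : ℝ} (hκ0 : 0 < κ) (hM : 0 < M) (h1 : 0 < ξ₁) : 0 < kappa1W κ M ξ₁ := by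
  unfold kappa1W; have := uK_pos (κ := κ) hκ0 hM h1; positivity

/-- **Lower power bound** `F_W(ξ) ≥ κ₁(ξ₁) ξ^{2m}` for `ξ ≥ ξ₁ > 0`. [new] -/
theorem profW_ge_rpow {κ M ξ₁ ξ : ℝ} (hκ0 : 0 < κ) (hκ1 : κ ≤ 1) (hM : 0 < M) (h1 : 0 < ξ₁) (hξ : ξ₁ ≤ ξ) :
    kappa1W κ M ξ₁ * ξ ^ (2 * expoW κ M) ≤ profW κ M ξ := by
  have hξ0 : 0 ≤ ξ := h1.le.trans hξ
  have hu := uK_mono (κ := κ) hκ0 hM h1.le hξ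
  have hu1 := uK_pos (κ := κ) hκ0 hM h1
  have hv := vW_ge hκ0 hκ1 hM hξ0
  have hsplit : (ξ ^ (2 - κ) / (4 * M + 1) ^ 2) ^ (2 * expoW κ M / (2 - κ))
      = ξ ^ (2 * expoW κ M) / ((4 * M + 1) ^ 2) ^ (2 * expoW κ M / (2 - κ)) := by
    rw [div_rpow (rpow_nonneg hξ0 _) (by positivity), rpow_X_e hκ1 hξ0]
  unfold kappa1W profW
  calc uK κ M ξ₁ * exp (-(expoW κ M * bigAW κ M / M)) / ((4 * M + 1) ^ 2) ^ (2 * expoW κ M / (2 - κ))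
        * ξ ^ (2 * expoW κ M)
      = uK κ M ξ₁ * (exp (-(expoW κ M * bigAW κ M / M))
          * (ξ ^ (2 - κ) / (4 * M + 1) ^ 2) ^ (2 * expoW κ M / (2 - κ))) := by rw [hsplit]; ring
    _ ≤ uK κ M ξ * vW κ M ξ := mul_le_mul hu hv (by positivity) (hu1.le.trans hu)

/-- `u ≥ h e^{−h}` (from `e^h ≥ 1 + h`). -/
theorem hK_mul_exp_le_uK (κ M ξ : ℝ) : hK κ M ξ * exp (-hK κ M ξ) ≤ uK κ M ξ := by
  unfold uK
  have h1 := add_one_le_exp (hK κ M ξ)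
  have h2 : exp (-hK κ M ξ) * exp (hK κ M ξ) = 1 := by rw [← exp_add, neg_add_cancel, exp_zero]
  have h3 : 0 < exp (-hK κ M ξ) := exp_pos _
  nlinarith

/-- The constant `κ₂(ξ₂) = e^{−h(ξ₂)} (M/κ)/(1+ξ₂²) · e^{−m(A/M + (2/(2−κ)) arsinh 2M)}`. [new] -/
def kappa2W (κ M ξ₂ : ℝ) : ℝ :=
  exp (-hK κ M ξ₂) * (M / κ) / (1 + ξ₂ ^ 2) * exp (-(expoW κ M * (bigAW κ M / M + 2 / (2 - κ) * arsinh (2 * M))))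

/-- `κ₂ > 0`. -/
theorem kappa2W_pos {κ M ξ₂ : ℝ} (hκ0 : 0 < κ) (hM : 0 < M) : 0 < kappa2W κ M ξ₂ := by
  unfold kappa2W; positivity

/-- **Lower quadratic bound** `F_W(ξ) ≥ κ₂(ξ₂) ξ²` for `0 ≤ ξ ≤ ξ₂`. [new] -/
theorem profW_ge_sq {κ M ξ₂ ξ : ℝ} (hκ0 : 0 < κ) (hκ1 : κ ≤ 1) (hM : 0 < M) (h2 : 0 < ξ₂) (h0 : 0 ≤ ξ)
    (hξ : ξ ≤ ξ₂) : kappa2W κ M ξ₂ * ξ ^ 2 ≤ profW κ M ξ := by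
  have hv := vW_ge_const hκ0 hκ1 hM h0
  -- `ξ^κ ≥ ξ²/(1+ξ₂²)`
  have hpow : ξ ^ 2 / (1 + ξ₂ ^ 2) ≤ ξ ^ κ := by
    rcases h0.eq_or_lt with h00 | hpos
    · rw [← h00, zero_rpow hκ0.ne']; simp
    rcases le_or_gt ξ 1 with h1 | h1
    · have hk : ξ ^ (2:ℝ) ≤ ξ ^ κ := rpow_le_rpow_of_exponent_ge hpos h1 (by linarith)
      rw [rpow_two] at hk
      have : ξ ^ 2 / (1 + ξ₂ ^ 2) ≤ ξ ^ 2 := div_le_self (sq_nonneg ξ) (by nlinarith)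
      linarith
    · have hk : 1 ≤ ξ ^ κ := one_le_rpow h1.le hκ0.le
      have : ξ ^ 2 / (1 + ξ₂ ^ 2) ≤ 1 := by
        rw [div_le_one (by positivity)]; nlinarith
      linarith
  -- `h(ξ) ≤ h(ξ₂)` hence `e^{−h(ξ₂)} ≤ e^{−h(ξ)}`
  have hh : hK κ M ξ ≤ hK κ M ξ₂ := by
    unfold hK; exact mul_le_mul_of_nonneg_left (rpow_le_rpow h0 hξ hκ0.le) (by positivity)
  have hE : exp (-hK κ M ξ₂) ≤ exp (-hK κ M ξ) := exp_le_exp.2 (by linarith)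
  have hu : exp (-hK κ M ξ₂) * (M / κ) / (1 + ξ₂ ^ 2) * ξ ^ 2 ≤ uK κ M ξ := by
    have step1 : exp (-hK κ M ξ₂) * (M / κ) / (1 + ξ₂ ^ 2) * ξ ^ 2
        = exp (-hK κ M ξ₂) * (M / κ * (ξ ^ 2 / (1 + ξ₂ ^ 2))) := by ring
    rw [step1]
    have step2 : M / κ * (ξ ^ 2 / (1 + ξ₂ ^ 2)) ≤ hK κ M ξ := by
      unfold hK; exact mul_le_mul_of_nonneg_left hpow (by positivity)
    calc exp (-hK κ M ξ₂) * (M / κ * (ξ ^ 2 / (1 + ξ₂ ^ 2)))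
        ≤ exp (-hK κ M ξ) * hK κ M ξ := mul_le_mul hE step2 (by positivity) (exp_pos _).le
      _ = hK κ M ξ * exp (-hK κ M ξ) := mul_comm _ _
      _ ≤ uK κ M ξ := hK_mul_exp_le_uK κ M ξ
  unfold kappa2W profW
  calc exp (-hK κ M ξ₂) * (M / κ) / (1 + ξ₂ ^ 2)
        * exp (-(expoW κ M * (bigAW κ M / M + 2 / (2 - κ) * arsinh (2 * M)))) * ξ ^ 2
      = (exp (-hK κ M ξ₂) * (M / κ) / (1 + ξ₂ ^ 2) * ξ ^ 2)
        * exp (-(expoW κ M * (bigAW κ M / M + 2 / (2 - κ) * arsinh (2 * M)))) := by ring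
    _ ≤ uK κ M ξ * vW κ M ξ := mul_le_mul hu hv (by positivity) (uK_nonneg hκ0 hM h0)

end Summit.NavierStokesRegularity.NavierStokesRegularity.Theorems.ZhangBarrier

end
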